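/-
Copyright (c) 2026. All rights reserved.
Released under Apache 2.0 license as described in the file LICENSE.
Authors: abc-iut cell, seat abc-iut-L4-t10 (gen 4; geometric `EA` column of [AbsTopIII] Prop 4.2 (i) /
Cor 4.5 — consumer of abc-iut-w5-d144's outer-rigidity junction at an arbitrary connected Riemann surface).
-/
import Literature.AnabelianGeometry.AbsoluteAnabelian.ArchimedeanHolFieldFunctorGeometricGaloisDescentCor45
import Literature.AnabelianGeometry.AbsoluteAnabelian.ArchimedeanHolFieldFunctorGeometricOuterRigid
import Literature.AnabelianGeometry.AbsoluteAnabelian.AbsTopIII.AutHolLogFrobeniusCor45FullModelProofs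
import HarnessLib

/-!
# [AbsTopIII] Prop 4.2 (i) / Cor 4.5 at the geometric `EA` over ONE connected Riemann surface `𝕏`,
# modulo «`Aut(𝕏) → Out(π̂₁(𝕏^top))` injective» — print's Lemma 4.3 input, and nothing else

S. Mochizuki, *Topics in Absolute Anabelian Geometry III*, proof of Prop. 4.2 (i), kurims p.106 l.11–19
(«… follows from the slimness … of Lemma 4.3»); Cor. 4.5 pp.107–109.

PROOF-ONLY consumer (seat abc-iut-L4-t10 gen 4).  abc-iut-w5-d144's
`ArchimedeanHolFieldFunctorGeometricOuterRigid` (`HolRS.isIdRigid_mapsTo_of_isSlimGroup_of_outer`,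
`…_of_center_eq_bot_of_outer`) turns the categorical residual (H1′) «`Over.map σ ≅ 𝟭 ⇒ σ = 1`» of the
Galois-descent route into print's own input (OUT) «an automorphism of `𝕏` acting on `π̂₁(𝕏^top, x₀)` by an
inner automorphism is trivial» (stated with a path `δ : x₀ ⇝ σ x₀` and the twist
`θ_{σ,δ} = (σ_*)⁻¹ ∘ Ad(δ)`).  Reading it through this seat's `…GaloisDescentCor45` /
`AutHolLogFrobeniusCor45FullModelProofs`:

* `HolRS.isIdRigid_EA_mapsTo_of_isSlimGroup_of_outer` / `…_of_center_eq_bot_of_outer` — `EA^hol_RS(Q_𝕏)`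
  (the full subcategory «objects mapping to `𝕏`») is id-rigid for `𝕏` with slim (resp. centre-free)
  `π̂₁(𝕏^top, x₀)`, modulo (OUT);
* `HolRS.isIdRigid_pairs_mapsTo_of_isSlimGroup_of_outer` — hence `𝒞^hol_TF`, `𝒞^hol_T` over it are
  id-rigid (Prop 4.2 (i));
* `HolRS.cor_4_5_geometric_mapsTo_of_isSlimGroup_of_outer` / `…_of_center_eq_bot_of_outer` — **Cor 4.5
  (i)(ii)(iv) + the (iii)-cores and (v) clauses AS TYPED (`AbsTopIII.Cor_4_5`)** for the archimedean
  log-Frobenius data over `EA^hol_RS(Q_𝕏)`, modulo (OUT);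
* `HolRS.cor_4_5_full_geometric_mapsTo_iff_of_isSlimGroup_of_outer` — there, `Cor_4_5_full` ⟺ the
  telecore half of (iii) (`LogObsCompatTelecoreStmt`), modulo (OUT).

HONEST SCOPE: (OUT) is a HYPOTHESIS (print's appeal to Lemma 4.3 for the orbicurve `[𝕏/⟨σ⟩]`; true for
hyperbolic Riemann surfaces of finite type, FALSE together with the conclusion at `ℂˣ` or an elliptic
curve); model ≠ reconstruction; support library, not a node; nothing here bears on [IUTchIII] Cor. 3.12.
No definitions, no instances, no named facts.
-/

noncomputable section

open CategoryTheory
open Literature.Topology.CoveringSpaces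
open Literature.AlgebraicGeometry.Frobenioids (IsSlimGroup)
open Literature.IUT.HodgeTheaters (profiniteCompletion toCompletion)

namespace Literature.AnabelianGeometry.AbsoluteAnabelian

namespace HolRS

variable (X : HolRS)

/-- **`EA^hol_RS(Q_𝕏)` is id-rigid when `π̂₁(𝕏^top, x₀)` is slim, modulo (OUT).**
[cite: MochizukiAbsTopIII2015, Proposition 4.2 (i) p.106] -/
theorem isIdRigid_EA_mapsTo_of_isSlimGroup_of_outer (x₀ : X.carrier)
    (h : IsSlimGroup (profiniteCompletion (FundamentalGroup X.carrier x₀)))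
    (hout : ∀ (σ : X ≅ X) (δ : Path x₀ (σ.hom.toFun x₀))
      (θ : FundamentalGroup X.carrier x₀ →* FundamentalGroup X.carrier x₀),
      (∀ γ : FundamentalGroup X.carrier x₀,
        Path.Homotopic.Quotient.map (FundamentalGroup.toPath (θ γ))
            ⟨σ.hom.toFun, σ.hom.mdifferentiable.continuous⟩ =
          (Path.Homotopic.Quotient.mk δ).symm.trans
            ((FundamentalGroup.toPath γ).trans (Path.Homotopic.Quotient.mk δ))) →
      (∃ n : profiniteCompletion (FundamentalGroup X.carrier x₀),
        ∀ γ : FundamentalGroup X.carrier x₀, toCompletion _ (θ γ) = n⁻¹ * toCompletion _ γ * n) →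
      σ.hom = 𝟙 X) :
    IsIdRigid (geometricAutHolFieldFunctor (fun Y : HolRS => Nonempty (Y ⟶ X))).EA :=
  X.isIdRigid_mapsTo_of_isSlimGroup_of_outer x₀ h hout

/-- **`EA^hol_RS(Q_𝕏)` is id-rigid when `Z(π̂₁(𝕏^top, x₀)) = 1`, modulo (OUT).**
[cite: MochizukiAbsTopIII2015, Proposition 4.2 (i) p.106] -/
theorem isIdRigid_EA_mapsTo_of_center_eq_bot_of_outer (x₀ : X.carrier)
    (hZ : Subgroup.center (profiniteCompletion (FundamentalGroup X.carrier x₀)) = ⊥)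
    (hout : ∀ (σ : X ≅ X) (δ : Path x₀ (σ.hom.toFun x₀))
      (θ : FundamentalGroup X.carrier x₀ →* FundamentalGroup X.carrier x₀),
      (∀ γ : FundamentalGroup X.carrier x₀,
        Path.Homotopic.Quotient.map (FundamentalGroup.toPath (θ γ))
            ⟨σ.hom.toFun, σ.hom.mdifferentiable.continuous⟩ =
          (Path.Homotopic.Quotient.mk δ).symm.trans
            ((FundamentalGroup.toPath γ).trans (Path.Homotopic.Quotient.mk δ))) →
      (∃ n : profiniteCompletion (FundamentalGroup X.carrier x₀),
        ∀ γ : FundamentalGroup X.carrier x₀, toCompletion _ (θ γ) = n⁻¹ * toCompletion _ γ * n) →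
      σ.hom = 𝟙 X) :
    IsIdRigid (geometricAutHolFieldFunctor (fun Y : HolRS => Nonempty (Y ⟶ X))).EA :=
  X.isIdRigid_mapsTo_of_center_eq_bot_of_outer x₀ hZ hout

/-- **Prop 4.2 (i): `𝒞^hol_TF` and `𝒞^hol_T` over `EA^hol_RS(Q_𝕏)` are id-rigid** when `π̂₁(𝕏^top, x₀)`
is slim, modulo (OUT). [cite: MochizukiAbsTopIII2015, Proposition 4.2 (i) p.105] -/
theorem isIdRigid_pairs_mapsTo_of_isSlimGroup_of_outer (x₀ : X.carrier)
    (h : IsSlimGroup (profiniteCompletion (FundamentalGroup X.carrier x₀)))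
    (hout : ∀ (σ : X ≅ X) (δ : Path x₀ (σ.hom.toFun x₀))
      (θ : FundamentalGroup X.carrier x₀ →* FundamentalGroup X.carrier x₀),
      (∀ γ : FundamentalGroup X.carrier x₀,
        Path.Homotopic.Quotient.map (FundamentalGroup.toPath (θ γ))
            ⟨σ.hom.toFun, σ.hom.mdifferentiable.continuous⟩ =
          (Path.Homotopic.Quotient.mk δ).symm.trans
            ((FundamentalGroup.toPath γ).trans (Path.Homotopic.Quotient.mk δ))) →
      (∃ n : profiniteCompletion (FundamentalGroup X.carrier x₀),
        ∀ γ : FundamentalGroup X.carrier x₀, toCompletion _ (θ γ) = n⁻¹ * toCompletion _ γ * n) →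
      σ.hom = 𝟙 X)
    {T : ArchPairType} (hT : T.IsMonoidType) :
    IsIdRigid (HolTFPair (geometricAutHolFieldFunctor (fun Y : HolRS => Nonempty (Y ⟶ X)))) ∧
    IsIdRigid (HolMonoidPair (geometricAutHolFieldFunctor (fun Y : HolRS => Nonempty (Y ⟶ X))) T) :=
  isIdRigid_pairs_of_isIdRigid_EA _ (X.isIdRigid_EA_mapsTo_of_isSlimGroup_of_outer x₀ h hout) hT

/-! ### [AbsTopIII] Cor 4.5 over `EA^hol_RS(Q_𝕏)`, modulo (OUT) -/

/-- **Cor 4.5 (i)(ii)(iv) with the (iii)-cores and (v) clauses AS TYPED (`AbsTopIII.Cor_4_5`) for the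
archimedean log-Frobenius data over `EA^hol_RS(Q_𝕏)`**, for `𝕏` with slim `π̂₁(𝕏^top, x₀)`, modulo
(OUT) (object `𝕏₀ := 𝕏`). [cite: MochizukiAbsTopIII2015, Corollary 4.5 pp.107–109] -/
theorem cor_4_5_geometric_mapsTo_of_isSlimGroup_of_outer (x₀ : X.carrier)
    (h : IsSlimGroup (profiniteCompletion (FundamentalGroup X.carrier x₀)))
    (hout : ∀ (σ : X ≅ X) (δ : Path x₀ (σ.hom.toFun x₀))
      (θ : FundamentalGroup X.carrier x₀ →* FundamentalGroup X.carrier x₀),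
      (∀ γ : FundamentalGroup X.carrier x₀,
        Path.Homotopic.Quotient.map (FundamentalGroup.toPath (θ γ))
            ⟨σ.hom.toFun, σ.hom.mdifferentiable.continuous⟩ =
          (Path.Homotopic.Quotient.mk δ).symm.trans
            ((FundamentalGroup.toPath γ).trans (Path.Homotopic.Quotient.mk δ))) →
      (∃ n : profiniteCompletion (FundamentalGroup X.carrier x₀),
        ∀ γ : FundamentalGroup X.carrier x₀, toCompletion _ (θ γ) = n⁻¹ * toCompletion _ γ * n) →
      σ.hom = 𝟙 X) :
    AbsTopIII.Cor_4_5
      (archLogFrobeniusData (geometricAutHolFieldFunctor (fun Y : HolRS => Nonempty (Y ⟶ X))))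
      (archTelecoreData (geometricAutHolFieldFunctor (fun Y : HolRS => Nonempty (Y ⟶ X)))) :=
  cor_4_5_geometric _ ⟨X, ⟨𝟙 X⟩⟩ (X.isIdRigid_EA_mapsTo_of_isSlimGroup_of_outer x₀ h hout)

/-- The same with `Z(π̂₁(𝕏^top, x₀)) = 1` in place of slimness, modulo (OUT).
[cite: MochizukiAbsTopIII2015, Corollary 4.5 pp.107–109] -/
theorem cor_4_5_geometric_mapsTo_of_center_eq_bot_of_outer (x₀ : X.carrier)
    (hZ : Subgroup.center (profiniteCompletion (FundamentalGroup X.carrier x₀)) = ⊥)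
    (hout : ∀ (σ : X ≅ X) (δ : Path x₀ (σ.hom.toFun x₀))
      (θ : FundamentalGroup X.carrier x₀ →* FundamentalGroup X.carrier x₀),
      (∀ γ : FundamentalGroup X.carrier x₀,
        Path.Homotopic.Quotient.map (FundamentalGroup.toPath (θ γ))
            ⟨σ.hom.toFun, σ.hom.mdifferentiable.continuous⟩ =
          (Path.Homotopic.Quotient.mk δ).symm.trans
            ((FundamentalGroup.toPath γ).trans (Path.Homotopic.Quotient.mk δ))) →
      (∃ n : profiniteCompletion (FundamentalGroup X.carrier x₀),
        ∀ γ : FundamentalGroup X.carrier x₀, toCompletion _ (θ γ) = n⁻¹ * toCompletion _ γ * n) →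
      σ.hom = 𝟙 X) :
    AbsTopIII.Cor_4_5
      (archLogFrobeniusData (geometricAutHolFieldFunctor (fun Y : HolRS => Nonempty (Y ⟶ X))))
      (archTelecoreData (geometricAutHolFieldFunctor (fun Y : HolRS => Nonempty (Y ⟶ X)))) :=
  cor_4_5_geometric _ ⟨X, ⟨𝟙 X⟩⟩ (X.isIdRigid_EA_mapsTo_of_center_eq_bot_of_outer x₀ hZ hout)

/-- **`Cor_4_5_full` over `EA^hol_RS(Q_𝕏)` ⟺ the telecore half of (iii)** (`LogObsCompatTelecoreStmt`),
for `𝕏` with slim `π̂₁(𝕏^top, x₀)`, modulo (OUT). [cite: MochizukiAbsTopIII2015, Corollary 4.5 pp.107–109] -/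
theorem cor_4_5_full_geometric_mapsTo_iff_of_isSlimGroup_of_outer (x₀ : X.carrier)
    (h : IsSlimGroup (profiniteCompletion (FundamentalGroup X.carrier x₀)))
    (hout : ∀ (σ : X ≅ X) (δ : Path x₀ (σ.hom.toFun x₀))
      (θ : FundamentalGroup X.carrier x₀ →* FundamentalGroup X.carrier x₀),
      (∀ γ : FundamentalGroup X.carrier x₀,
        Path.Homotopic.Quotient.map (FundamentalGroup.toPath (θ γ))
            ⟨σ.hom.toFun, σ.hom.mdifferentiable.continuous⟩ =
          (Path.Homotopic.Quotient.mk δ).symm.trans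
            ((FundamentalGroup.toPath γ).trans (Path.Homotopic.Quotient.mk δ))) →
      (∃ n : profiniteCompletion (FundamentalGroup X.carrier x₀),
        ∀ γ : FundamentalGroup X.carrier x₀, toCompletion _ (θ γ) = n⁻¹ * toCompletion _ γ * n) →
      σ.hom = 𝟙 X) :
    AbsTopIII.Cor_4_5_full
        (archLogFrobeniusData (geometricAutHolFieldFunctor (fun Y : HolRS => Nonempty (Y ⟶ X))))
        (archTelecoreData (geometricAutHolFieldFunctor (fun Y : HolRS => Nonempty (Y ⟶ X)))) ↔
      (archLogFrobeniusData
        (geometricAutHolFieldFunctor (fun Y : HolRS => Nonempty (Y ⟶ X)))).LogObsCompatTelecoreStmt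
        (archTelecoreData (geometricAutHolFieldFunctor (fun Y : HolRS => Nonempty (Y ⟶ X)))) :=
  cor_4_5_full_geometric_iff _ ⟨X, ⟨𝟙 X⟩⟩ (X.isIdRigid_EA_mapsTo_of_isSlimGroup_of_outer x₀ h hout)

end HolRS

end Literature.AnabelianGeometry.AbsoluteAnabelian
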